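import Literature.AlgebraicGeometry.Frobenioids.PerfectionIsFrobenioid
import Literature.AlgebraicGeometry.Frobenioids.PerfectionEquivalence
import Literature.AlgebraicGeometry.Frobenioids.DivisorMonoidCategoryTheoreticityProofs
import HarnessLib

/-!
# Frobenioids I, Proposition 3.2 (iii) AS TYPED, for THE perfection: "`C^pf` … is a Frobenioid of perfect
# and isotropic type. Moreover, there is a natural equivalence of categories `C^pf ⥲ (C^pf)^pf`." (PROOFS)

Mochizuki, *The geometry of Frobenioids I: the general theory*, Kyushu J. Math. **62** (2008)
293–400, Proposition 3.2 (iii) p. 59 [cite: MochizukiFrdI2008, Prop. 3.2 (iii) p.59].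

With "`C^pf` is a Frobenioid" in the tree (`Perfection.isFrobenioid`, `PerfectionIsFrobenioid.lean`), the
perfection `(C^pf)^pf` of `C^pf` is THE perfection datum `PreFrobenioidData.perfection (isFrobenioid hF hiso)`
(seat abc-iut-L1-d9), and its functor `C^pf → (C^pf)^pf`, `X ↦ (X, 1)`, is an equivalence because `C^pf` is of
perfect type (`isOfPerfectType_perfection`, `toPf_isEquivalence`; seat abc-iut-L1-d1).  This discharges the
third conjunct of the typed statement `Prop32iii` (`BaseCategoryTheoreticityDefs.lean`, seat abc-iut-L1-t3)
— previously CONDITIONAL in `prop32iii_of_toPf_isEquivalence` (`PerfectionLifting.lean`) — for THE two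
perfection data: `prop32iii_perfection` (the functor-level isotropic-type clause is `isOfIsotropicType_toFunctor`,
`PerfectionStandardTypes.lean`, seat abc-iut-w5-d042).  No new definitions; nothing here is specific to the abc programme.
-/

namespace Literature.AlgebraicGeometry.Frobenioids

namespace PreFrobenioid

namespace Perfection

open CategoryTheory Opposite

universe w v v' u u'

variable {D : Type u} [Category.{v} D] {Φ : Dᵒᵖ ⥤ CommMonCat.{w}}
  {C : Type u'} [Category.{v'} C] {F : C ⥤ ElemFrobenioid Φ}

/-- `C^pf` is of perfect type, functor-level (for the structure functor `C^pf → F_{Φ^pf}`).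
[cite: MochizukiFrdI2008, Prop. 3.2 (iii) p.59] -/
theorem isOfPerfectType_toFunctor (hF : IsFrobenioid F) (hiso : IsOfType (IsFrobeniusIsotropic F)) :
    PreFrobenioid.IsOfPerfectType (ops hF).toFunctor :=
  (PreFrobenioidData.ofFunctor_isOfPerfectType (ops hF).toFunctor).mp (isOfPerfectType_perfection hF hiso)

/-- **"There is a natural equivalence of categories `C^pf ⥲ (C^pf)^pf`"** (Prop. 3.2 (iii)): the functor
`X ↦ (X, 1)` from the Frobenioid `C^pf` to ITS perfection is an equivalence (`C^pf` is of perfect type).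
[cite: MochizukiFrdI2008, Prop. 3.2 (iii) p.59] -/
theorem toPf_isEquivalence_of_perfection (hF : IsFrobenioid F) (hiso : IsOfType (IsFrobeniusIsotropic F)) :
    (Perfection.toPf (isFrobenioid hF hiso)).IsEquivalence :=
  toPf_isEquivalence (isFrobenioid hF hiso) (isOfPerfectType_toFunctor hF hiso)

/-- The equivalence `C^pf ≌ (C^pf)^pf` as data (the functor `X ↦ (X, 1)` upgraded to an equivalence).
[cite: MochizukiFrdI2008, Prop. 3.2 (iii) p.59] -/
theorem nonempty_equivalence_perfection_perfection (hF : IsFrobenioid F)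
    (hiso : IsOfType (IsFrobeniusIsotropic F)) :
    Nonempty (Perfection hF ≌ Perfection (isFrobenioid hF hiso)) :=
  haveI := toPf_isEquivalence_of_perfection hF hiso
  ⟨(Perfection.toPf (isFrobenioid hF hiso)).asEquivalence⟩

/-- **Proposition 3.2 (iii) AS TYPED, DISCHARGED** for THE perfection datum `PreFrobenioidData.perfection hF` of
a Frobenioid of Frobenius-isotropic type and THE perfection datum of the Frobenioid `C^pf`: `C^pf` is of
perfect type, of isotropic type, and `C^pf → (C^pf)^pf` is an equivalence of categories.
[cite: MochizukiFrdI2008, Prop. 3.2 (iii) p.59] -/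
theorem prop32iii_perfection (hF : IsFrobenioid F) (hiso : IsOfType (IsFrobeniusIsotropic F)) :
    Prop32iii (PreFrobenioidData.ofFunctor Φ F) (PreFrobenioidData.perfection hF)
      (PreFrobenioidData.perfection (isFrobenioid hF hiso)) :=
  prop32iii_of_toPf_isEquivalence hF hiso _ (toPf_isEquivalence_of_perfection hF hiso)

end Perfection

end PreFrobenioid

end Literature.AlgebraicGeometry.Frobenioids
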